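import Literature.Topology.FourManifolds.TubeLink
import Literature.Topology.FourManifolds.RadialExtension
import HarnessLib

/-!
# The link family of the normal part: smoothness, globalisation, injective differentials

Topic `Literature/Topology/FourManifolds`; companion of `TubeLink.lean`, `TubeSphereFamily.lean` and
`TubeUntwistFamily.lean` (codimension `q = k + 1 ≥ 2` steps of the smoothing of PD homeomorphisms:
Munkres, Ann. of Math. 72 (1960), §§4–5; Campbell–D'Onofrio–Vítek, J. Geom. Anal. (2026), Lemma 3.4).
For the normal part `N : E × ℝᵏ⁺¹ → ℝᵏ⁺¹` of a stage map and a reading radius `r₁ > 0`, the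
**link family** is the family of sphere maps

  `linkSphereMap θ₀ N r₁ x θ = N (x, r₁ θ) / ‖N (x, r₁ θ)‖ ∈ 𝕊ᵏ`.

We prove: joint smoothness in `(x, θ)` wherever `N` is smooth and nonzero on the sphere bundle of
radius `r₁` (`contMDiffAt_uncurry_linkSphereMap`); **injectivity of the differential of each
stage** from the radial transversality of `N` at `(x, r₁θ)` (`injective_mfderiv_linkSphereMap`,
the kernel computation of `TubeLink.lean` transported to `mfderiv`); and a **globalisation**
device `globalizeFamily χ x₀ ĥ x = ĥ (x₀ + χ x • (x − x₀))` by a cutoff `χ` (`= ĥ` where `χ = 1`,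
globally jointly smooth as soon as `ĥ` is jointly smooth on a star-shaped neighbourhood of `x₀`
containing the reach of the cutoff), so that the global hypotheses of `TubeSphereFamily.lean` /
`TubeUntwistFamily.lean` are met by locally defined links.  Definitions are explicit functions;
no named facts.

## References

* J. R. Munkres, *Obstructions to the smoothing of piecewise-differentiable homeomorphisms*, Ann.
  of Math. (2) 72 (1960), 521–554, §§4–5. [Munkres1960]
* D. Campbell, L. D'Onofrio, T. Vítek, *Diffeomorphic approximation of piecewise affine
  homeomorphisms*, J. Geom. Anal. 36 (2026), Lemma 3.4. [CampbellDonofrioVitek2026]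
-/

noncomputable section

open Set Function Metric Module Filter
open scoped Manifold ContDiff Topology RealInnerProductSpace

namespace Literature.Topology.FourManifolds

variable {k : ℕ} {E : Type*} [NormedAddCommGroup E] [NormedSpace ℝ E]

/-! ### The link family -/

/-- **The link family of the normal part at radius `r₁`**:
`linkSphereMap θ₀ N r₁ x θ = π (N (x, r₁ θ))`, `π` the radial projection (junk `θ₀` where `N = 0`).
[cite: CampbellDonofrioVitek2026, Lemma 3.4 (Step 1)] -/
def linkSphereMap (θ₀ : sphere (0 : EuclideanSpace ℝ (Fin (k + 1))) 1)
    (N : E × EuclideanSpace ℝ (Fin (k + 1)) → EuclideanSpace ℝ (Fin (k + 1))) (r₁ : ℝ) (x : E)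
    (θ : sphere (0 : EuclideanSpace ℝ (Fin (k + 1))) 1) : sphere (0 : EuclideanSpace ℝ (Fin (k + 1))) 1 :=
  radialProjection θ₀ (N (x, r₁ • (θ : EuclideanSpace ℝ (Fin (k + 1)))))

variable {θ₀ : sphere (0 : EuclideanSpace ℝ (Fin (k + 1))) 1}
  {N : E × EuclideanSpace ℝ (Fin (k + 1)) → EuclideanSpace ℝ (Fin (k + 1))} {r₁ : ℝ}

omit [NormedAddCommGroup E] [NormedSpace ℝ E] in
/-- The link family in coordinates: `N (x, r₁θ)/‖N (x, r₁θ)‖` where `N ≠ 0`. [folklore] -/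
theorem coe_linkSphereMap {x : E} {θ : sphere (0 : EuclideanSpace ℝ (Fin (k + 1))) 1}
    (hN : N (x, r₁ • (θ : EuclideanSpace ℝ (Fin (k + 1)))) ≠ 0) :
    (linkSphereMap θ₀ N r₁ x θ : EuclideanSpace ℝ (Fin (k + 1))) =
      ‖N (x, r₁ • (θ : EuclideanSpace ℝ (Fin (k + 1))))‖⁻¹ • N (x, r₁ • (θ : EuclideanSpace ℝ (Fin (k + 1)))) :=
  coe_radialProjection_of_ne_zero θ₀ hN

/-- **Joint smoothness of the link family** at `(x, θ)`: `N` smooth and nonzero at `(x, r₁θ)`.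
[folklore] -/
theorem contMDiffAt_uncurry_linkSphereMap {x : E} {θ : sphere (0 : EuclideanSpace ℝ (Fin (k + 1))) 1}
    (hN : ContDiffAt ℝ ∞ N (x, r₁ • (θ : EuclideanSpace ℝ (Fin (k + 1)))))
    (hN0 : N (x, r₁ • (θ : EuclideanSpace ℝ (Fin (k + 1)))) ≠ 0) :
    ContMDiffAt (𝓘(ℝ, E).prod (𝓡 k)) (𝓡 k) ∞ (uncurry (linkSphereMap θ₀ N r₁)) (x, θ) := by
  haveI : Fact (finrank ℝ (EuclideanSpace ℝ (Fin (k + 1))) = k + 1) := ⟨finrank_euclideanSpace_fin⟩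
  have h1 : ContMDiff (𝓘(ℝ, E).prod (𝓡 k)) 𝓘(ℝ, E × EuclideanSpace ℝ (Fin (k + 1))) ∞
      (fun q : E × sphere (0 : EuclideanSpace ℝ (Fin (k + 1))) 1 =>
        ((q.1, r₁ • (q.2 : EuclideanSpace ℝ (Fin (k + 1)))) : E × EuclideanSpace ℝ (Fin (k + 1)))) := by
    have hs : ContMDiff (𝓘(ℝ, E).prod (𝓡 k)) 𝓘(ℝ, EuclideanSpace ℝ (Fin (k + 1))) ∞
        (fun q : E × sphere (0 : EuclideanSpace ℝ (Fin (k + 1))) 1 =>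
          (q.2 : EuclideanSpace ℝ (Fin (k + 1)))) :=
      (contMDiff_coe_sphere (n := k)).comp contMDiff_snd
    exact contMDiff_fst.prodMk_space
      (((contDiff_const_smul (𝕜 := ℝ) (F := EuclideanSpace ℝ (Fin (k + 1))) r₁).contMDiff).comp hs)
  have h2 : ContMDiffAt (𝓘(ℝ, E).prod (𝓡 k)) 𝓘(ℝ, EuclideanSpace ℝ (Fin (k + 1))) ∞
      (fun q : E × sphere (0 : EuclideanSpace ℝ (Fin (k + 1))) 1 =>
        N (q.1, r₁ • (q.2 : EuclideanSpace ℝ (Fin (k + 1))))) (x, θ) :=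
    hN.contMDiffAt.comp (x, θ) (h1 (x, θ))
  exact (contMDiffAt_radialProjection θ₀ hN0).comp (x, θ) h2

/-! ### Injectivity of the differential of a link stage -/

/-- **Radial transversality gives link stages with injective differential.** Let `x : E`,
`θ ∈ 𝕊ᵏ`, `r₁ > 0`, `q = (x, r₁θ)`, `N` smooth at `q` with `N q ≠ 0`, with injective fibre
derivative `u ↦ DN(q)(0,u)` and radially transversal (`DN(q)(0,v) = N q ⟹ ⟪v, θ⟫ > 0`).  Then
the differential of the link stage `linkSphereMap θ₀ N r₁ x : 𝕊ᵏ → 𝕊ᵏ` at `θ` is injective.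
(Kernel computation of `TubeLink.eq_zero_of_fderiv_mem_span_of_transversal`, transported through
`dι` and `dπ`.) [cite: CampbellDonofrioVitek2026, Lemma 3.4 (Step 1)] -/
theorem injective_mfderiv_linkSphereMap (hr : 0 < r₁) {x : E}
    {θ : sphere (0 : EuclideanSpace ℝ (Fin (k + 1))) 1}
    (hN : ContDiffAt ℝ ∞ N (x, r₁ • (θ : EuclideanSpace ℝ (Fin (k + 1)))))
    (hN0 : N (x, r₁ • (θ : EuclideanSpace ℝ (Fin (k + 1)))) ≠ 0)
    (hinj : ∀ u : EuclideanSpace ℝ (Fin (k + 1)),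
      fderiv ℝ N (x, r₁ • (θ : EuclideanSpace ℝ (Fin (k + 1)))) (0, u) = 0 → u = 0)
    (htr : ∀ v : EuclideanSpace ℝ (Fin (k + 1)),
      fderiv ℝ N (x, r₁ • (θ : EuclideanSpace ℝ (Fin (k + 1)))) (0, v) =
        N (x, r₁ • (θ : EuclideanSpace ℝ (Fin (k + 1)))) →
          0 < ⟪v, (θ : EuclideanSpace ℝ (Fin (k + 1)))⟫) :
    Injective (mfderiv (𝓡 k) (𝓡 k) (linkSphereMap θ₀ N r₁ x) θ) := by
  haveI : Fact (finrank ℝ (EuclideanSpace ℝ (Fin (k + 1))) = k + 1) := ⟨finrank_euclideanSpace_fin⟩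
  -- the Euclidean map `Ψ y = N (x, r₁ y)` and its derivative
  set Ψ : EuclideanSpace ℝ (Fin (k + 1)) → EuclideanSpace ℝ (Fin (k + 1)) := fun y => N (x, r₁ • y) with hΨ
  have hy : ((θ : EuclideanSpace ℝ (Fin (k + 1)))) ≠ 0 := ne_zero_of_mem_unit_sphere θ
  have hι : HasFDerivAt (fun y : EuclideanSpace ℝ (Fin (k + 1)) => ((x, r₁ • y) : E × _))
      ((0 : EuclideanSpace ℝ (Fin (k + 1)) →L[ℝ] E).prod (r₁ • ContinuousLinearMap.id ℝ _))
      (θ : EuclideanSpace ℝ (Fin (k + 1))) :=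
    (hasFDerivAt_const x _).prodMk ((hasFDerivAt_id _).const_smul r₁)
  have hNd : DifferentiableAt ℝ N (x, r₁ • (θ : EuclideanSpace ℝ (Fin (k + 1)))) :=
    hN.differentiableAt (by simp)
  have hΨd : HasFDerivAt Ψ ((fderiv ℝ N (x, r₁ • (θ : EuclideanSpace ℝ (Fin (k + 1))))).comp
      ((0 : EuclideanSpace ℝ (Fin (k + 1)) →L[ℝ] E).prod (r₁ • ContinuousLinearMap.id ℝ _)))
      (θ : EuclideanSpace ℝ (Fin (k + 1))) :=
    HasFDerivAt.comp ((θ : EuclideanSpace ℝ (Fin (k + 1)))) hNd.hasFDerivAt hι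
  have hΨapply : ∀ w, fderiv ℝ Ψ (θ : EuclideanSpace ℝ (Fin (k + 1))) w =
      r₁ • fderiv ℝ N (x, r₁ • (θ : EuclideanSpace ℝ (Fin (k + 1)))) (0, w) := fun w => by
    rw [hΨd.fderiv]
    change fderiv ℝ N (x, r₁ • (θ : EuclideanSpace ℝ (Fin (k + 1)))) ((0 : E), r₁ • w) = _
    rw [← map_smul]
    congr 1
    ext <;> simp
  -- transversality data for `Ψ` at `θ`
  have hΨinj : Injective (fderiv ℝ Ψ (θ : EuclideanSpace ℝ (Fin (k + 1)))) := by
    refine (injective_iff_map_eq_zero _).2 fun w hw => ?_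
    rw [hΨapply] at hw
    exact hinj w ((smul_eq_zero.1 hw).resolve_left hr.ne')
  have hΨtr : ∀ v, fderiv ℝ Ψ (θ : EuclideanSpace ℝ (Fin (k + 1))) v = Ψ θ →
      0 < ⟪v, (θ : EuclideanSpace ℝ (Fin (k + 1)))⟫ := fun v hv => by
    rw [hΨapply] at hv
    have h1 : fderiv ℝ N (x, r₁ • (θ : EuclideanSpace ℝ (Fin (k + 1)))) (0, r₁ • v) =
        N (x, r₁ • (θ : EuclideanSpace ℝ (Fin (k + 1)))) := by
      have : (((0 : E), r₁ • v) : E × EuclideanSpace ℝ (Fin (k + 1))) = r₁ • ((0 : E), v) := by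
        ext <;> simp
      rw [this, map_smul]
      exact hv
    have h2 := htr _ h1
    rw [real_inner_smul_left] at h2
    exact (mul_pos_iff_of_pos_left hr).1 h2
  -- the stage is `π ∘ Ψ ∘ ι`; compute its differential through `ι ∘ stage = (normalize ∘ Ψ) ∘ ι`
  set f := linkSphereMap θ₀ N r₁ x with hf
  have hfΨ : f = radialProjection θ₀ ∘ Ψ ∘ Subtype.val := rfl
  have hΨ0 : Ψ θ ≠ 0 := hN0
  have hΨc : ContDiffAt ℝ ∞ Ψ (θ : EuclideanSpace ℝ (Fin (k + 1))) := by
    have : ContDiffAt ℝ ∞ (fun y : EuclideanSpace ℝ (Fin (k + 1)) => ((x, r₁ • y) : E × _)) θ :=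
      contDiffAt_const.prodMk (contDiffAt_id.const_smul r₁)
    exact hN.comp (θ : EuclideanSpace ℝ (Fin (k + 1))) this
  have hfd : MDifferentiableAt (𝓡 k) (𝓡 k) f θ := by
    rw [hfΨ]
    refine ((contMDiffAt_radialProjection θ₀ hΨ0).comp θ
      (hΨc.contMDiffAt.comp θ (contMDiff_coe_sphere (n := k)).contMDiffAt)).mdifferentiableAt (by simp)
  refine (injective_iff_map_eq_zero _).2 fun v hv => ?_
  -- push forward by `dι`
  have hιf : mfderiv (𝓡 k) 𝓘(ℝ, EuclideanSpace ℝ (Fin (k + 1))) (Subtype.val ∘ f) θ v = 0 := by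
    rw [mfderiv_comp θ ((contMDiff_coe_sphere (m := ∞) (n := k)).mdifferentiableAt (by simp)) hfd]
    change (mfderiv (𝓡 k) 𝓘(ℝ, EuclideanSpace ℝ (Fin (k + 1))) Subtype.val (f θ))
      ((mfderiv (𝓡 k) (𝓡 k) f θ) v) = 0
    rw [hv, map_zero]
  -- `ι ∘ f = (normalize ∘ Ψ) ∘ ι` near `θ`
  set w : EuclideanSpace ℝ (Fin (k + 1)) :=
    mfderiv (𝓡 k) 𝓘(ℝ, EuclideanSpace ℝ (Fin (k + 1))) Subtype.val θ v with hw
  have hev : (Subtype.val ∘ f) =ᶠ[𝓝 θ]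
      ((fun z : EuclideanSpace ℝ (Fin (k + 1)) => ‖z‖⁻¹ • z) ∘ Ψ) ∘ Subtype.val := by
    have hmem : {θ' : sphere (0 : EuclideanSpace ℝ (Fin (k + 1))) 1 | Ψ θ' ≠ 0} ∈ 𝓝 θ :=
      (hΨc.continuousAt.comp continuous_subtype_val.continuousAt).preimage_mem_nhds
        (isOpen_ne.mem_nhds hΨ0)
    filter_upwards [hmem] with θ' hθ'
    exact coe_radialProjection_of_ne_zero θ₀ hθ'
  have hnΨ : DifferentiableAt ℝ ((fun z : EuclideanSpace ℝ (Fin (k + 1)) => ‖z‖⁻¹ • z) ∘ Ψ)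
      (θ : EuclideanSpace ℝ (Fin (k + 1))) :=
    ((Literature.Geometry.Riemannian.contDiffAt_inv_norm_smul (m := ∞) hΨ0).comp _ hΨc).differentiableAt
      (by simp)
  have hchain : mfderiv (𝓡 k) 𝓘(ℝ, EuclideanSpace ℝ (Fin (k + 1))) (Subtype.val ∘ f) θ v =
      fderiv ℝ ((fun z : EuclideanSpace ℝ (Fin (k + 1)) => ‖z‖⁻¹ • z) ∘ Ψ)
        (θ : EuclideanSpace ℝ (Fin (k + 1))) w := by
    rw [hev.mfderiv_eq, mfderiv_comp θ hnΨ.mdifferentiableAt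
      ((contMDiff_coe_sphere (m := ∞) (n := k)).mdifferentiableAt (by simp)), mfderiv_eq_fderiv]
    rfl
  have h0 : fderiv ℝ (fun z : EuclideanSpace ℝ (Fin (k + 1)) => ‖z‖⁻¹ • z) (Ψ θ)
      (fderiv ℝ Ψ (θ : EuclideanSpace ℝ (Fin (k + 1))) w) = 0 := by
    have := hιf
    rw [hchain, fderiv_comp ((θ : EuclideanSpace ℝ (Fin (k + 1))))
      ((Literature.Geometry.Riemannian.contDiffAt_inv_norm_smul
      (m := ∞) hΨ0).differentiableAt (by simp)) (hΨc.differentiableAt (by simp))] at this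
    exact this
  obtain ⟨c, hc⟩ :=
    Literature.Geometry.Riemannian.exists_eq_smul_of_fderiv_inv_norm_smul_eq_zero hΨ0 h0
  -- `w ⊥ θ`
  have hwperp : ⟪(θ : EuclideanSpace ℝ (Fin (k + 1))), w⟫ = 0 := by
    have hwmem : (mfderiv (𝓡 k) 𝓘(ℝ, EuclideanSpace ℝ (Fin (k + 1)))
        (Subtype.val : sphere (0 : EuclideanSpace ℝ (Fin (k + 1))) 1 → EuclideanSpace ℝ (Fin (k + 1)))
          θ v : EuclideanSpace ℝ (Fin (k + 1))) ∈
            (ℝ ∙ (θ : EuclideanSpace ℝ (Fin (k + 1))))ᗮ := by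
      rw [← range_mfderiv_coe_sphere (n := k) θ]
      exact LinearMap.mem_range_self _ v
    exact Submodule.mem_orthogonal_singleton_iff_inner_right.1 hwmem
  have hw0 : w = 0 := eq_zero_of_fderiv_mem_span_of_transversal hΨinj hΨtr hwperp ⟨c, hc⟩
  -- `dι` is injective
  have := mfderiv_coe_sphere_injective (n := k) θ
  refine (injective_iff_map_eq_zero _).1 this v ?_
  exact hw0

/-! ### Globalisation by a cutoff in the parameter -/

/-- **Globalised family**: `globalizeFamily χ x₀ ĥ x = ĥ (x₀ + χ x • (x − x₀))` — equal to `ĥ`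
where `χ = 1`, constant `ĥ x₀` where `χ = 0`. [folklore] -/
def globalizeFamily {S : Type*} (χ : E → ℝ) (x₀ : E) (ĥ : E → S) (x : E) : S :=
  ĥ (x₀ + χ x • (x - x₀))

/-- Where the cutoff is `1` the globalised family is the original one. [folklore] -/
theorem globalizeFamily_of_eq_one {S : Type*} {χ : E → ℝ} {x₀ : E} {ĥ : E → S} {x : E}
    (hx : χ x = 1) : globalizeFamily χ x₀ ĥ x = ĥ x := by
  rw [globalizeFamily, hx, one_smul, add_sub_cancel]

/-- Where the cutoff is `0` the globalised family is the base stage. [folklore] -/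
theorem globalizeFamily_of_eq_zero {S : Type*} {χ : E → ℝ} {x₀ : E} {ĥ : E → S} {x : E}
    (hx : χ x = 0) : globalizeFamily χ x₀ ĥ x = ĥ x₀ := by
  rw [globalizeFamily, hx, zero_smul, add_zero]

/-- The reach of the cutoff: with `χ x ∈ [0, 1]` the point `x₀ + χ x • (x − x₀)` lies on the
segment `[x₀, x]`, and it is `x₀` itself when `χ x = 0`. [folklore] -/
theorem globalize_point_mem_segment {χ : E → ℝ} {x₀ : E} (hχ : ∀ x, χ x ∈ Icc (0 : ℝ) 1) (x : E) :
    x₀ + χ x • (x - x₀) ∈ segment ℝ x₀ x := by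
  refine ⟨1 - χ x, χ x, by linarith [(hχ x).2], (hχ x).1, by ring, ?_⟩
  simp only [smul_sub, sub_smul, one_smul]
  abel

/-- **The globalised link family is jointly smooth everywhere** if `χ` is smooth with values in
`[0, 1]` and vanishing off a set `B`, and `ĥ` is jointly smooth at every `(x', θ)` with `x'` on a
segment `[x₀, x]`, `x ∈ B`, and at `(x₀, θ)`. [folklore] -/
theorem contMDiff_uncurry_globalizeFamily
    {ĥ : E → sphere (0 : EuclideanSpace ℝ (Fin (k + 1))) 1 → sphere (0 : EuclideanSpace ℝ (Fin (k + 1))) 1}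
    {χ : E → ℝ} {x₀ : E} {B : Set E} (hχ : ContDiff ℝ ∞ χ) (hχ01 : ∀ x, χ x ∈ Icc (0 : ℝ) 1)
    (hχB : ∀ x ∉ B, χ x = 0)
    (hĥ : ∀ x ∈ B, ∀ x' ∈ segment ℝ x₀ x, ∀ θ,
      ContMDiffAt (𝓘(ℝ, E).prod (𝓡 k)) (𝓡 k) ∞ (uncurry ĥ) (x', θ))
    (hĥ₀ : ∀ θ, ContMDiffAt (𝓘(ℝ, E).prod (𝓡 k)) (𝓡 k) ∞ (uncurry ĥ) (x₀, θ)) :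
    ContMDiff (𝓘(ℝ, E).prod (𝓡 k)) (𝓡 k) ∞ (uncurry (globalizeFamily χ x₀ ĥ)) := by
  intro q
  obtain ⟨x, θ⟩ := q
  have hpt : ContMDiff (𝓘(ℝ, E).prod (𝓡 k)) (𝓘(ℝ, E).prod (𝓡 k)) ∞
      (fun q : E × sphere (0 : EuclideanSpace ℝ (Fin (k + 1))) 1 => (x₀ + χ q.1 • (q.1 - x₀), q.2)) := by
    have h1 : ContMDiff (𝓘(ℝ, E).prod (𝓡 k)) 𝓘(ℝ, E) ∞
        (fun q : E × sphere (0 : EuclideanSpace ℝ (Fin (k + 1))) 1 => x₀ + χ q.1 • (q.1 - x₀)) := by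
      have hx : ContDiff ℝ ∞ (fun x : E => x₀ + χ x • (x - x₀)) :=
        contDiff_const.add (hχ.smul (contDiff_id.sub contDiff_const))
      exact hx.contMDiff.comp contMDiff_fst
    exact h1.prodMk contMDiff_snd
  have htarget : ContMDiffAt (𝓘(ℝ, E).prod (𝓡 k)) (𝓡 k) ∞ (uncurry ĥ) (x₀ + χ x • (x - x₀), θ) := by
    by_cases hxB : x ∈ B
    · exact hĥ x hxB _ (globalize_point_mem_segment hχ01 x) θ
    · rw [hχB x hxB, zero_smul, add_zero]
      exact hĥ₀ θ
  exact htarget.comp (x, θ) (hpt (x, θ))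

/-- Stage differentials of the globalised family are those of the original family at the moved
parameter (definitional), so injectivity transfers. [folklore] -/
theorem injective_mfderiv_globalizeFamily_stage
    {ĥ : E → sphere (0 : EuclideanSpace ℝ (Fin (k + 1))) 1 → sphere (0 : EuclideanSpace ℝ (Fin (k + 1))) 1}
    {χ : E → ℝ} {x₀ : E}
    (hinj : ∀ (x : E) (θ : sphere (0 : EuclideanSpace ℝ (Fin (k + 1))) 1),
      Injective (mfderiv (𝓡 k) (𝓡 k) (ĥ x) θ))
    (x : E) (θ : sphere (0 : EuclideanSpace ℝ (Fin (k + 1))) 1) :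
    Injective (mfderiv (𝓡 k) (𝓡 k) (globalizeFamily χ x₀ ĥ x) θ) :=
  hinj _ θ

end Literature.Topology.FourManifolds
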